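import Summits.ABC.ABC.Theses.FeketeScales
import Literature.NumberTheory.DiophantineGeometry.XYZConjectureABCExponent

/-!
# `SubmultOfRST` (stmt-ABC-10340): pointwise sub-power slack ⇒ scale sub-multiplicativity

Route `FeketeScales` (ABC/ABC), support item.  If for some `τ < 1` and some real `A` every abc triple
satisfies `c < rad(abc) · exp(A · (log rad)^τ)`, then `ScaleSubmultiplicativity` holds, with
`θ = (1 + max τ 0)/2`, `K = 16` and `R₀` large.

**Proof.**
* Witnesses at every scale: for `R ≥ 4` let `m = ⌊log₂ R⌋ ≥ 2` and `n = m - 1 ≥ 1`; the abc triple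
  `(1, 2ⁿ - 1, 2ⁿ)` has `rad ≤ 2 (2ⁿ - 1) < 2ᵐ ≤ R` and `4 · 2ⁿ = 2^{m+1} > R`
  (`isABCTriple_one_two_pow_sub_one`, `rad_one_two_pow_sub_one_le` from
  `Literature.NumberTheory.DiophantineGeometry.XYZConjectureABCExponent`).
* Normalisation of the slack: with `τ⁺ = max τ 0` and `B = |A| · max 1 ((log 2)^τ)`, every abc triple with
  `rad ≤ P` has `A (log rad)^τ ≤ B (log P)^{τ⁺}` (for `τ ≥ 0` by monotonicity of `x ↦ x^τ`; for `τ < 0`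
  because `rad ≥ 2` gives `(log rad)^τ ≤ (log 2)^τ`, or `log rad = 0`).
* Threshold: `(log P)^{(1-τ⁺)/2} → ∞`, so for `P ≥ N₀` it exceeds `B`, whence
  `B (log P)^{τ⁺} ≤ (log P)^{(1-τ⁺)/2 + τ⁺} = (log P)^θ`.
* Assembly: for `R₁, R₂ ≥ R₀ := max 4 N₀`, `P = R₁R₂ ≥ N₀` and the witnesses `cᵢ > Rᵢ/4` give
  `c < rad · e^{A (log rad)^τ} ≤ P e^{(log P)^θ} < 16 c₁ c₂ e^{(log P)^θ}`.

Sources: the route file's docstring for item stmt-ABC-10340 (planner's sketch);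
[RobertStewartTenenbaum2014, §1] for the shape of the slack.  Uses only Mathlib and the two
witness-family lemmas above.
-/

-- `Summit.<Summit>.<Problem>` is the mandated summit-side namespace (CONVENTIONS §2); for the
-- single-conjunct summit `ABC` the two coincide, so the duplicate `ABC.ABC` is deliberate.
set_option linter.dupNamespace false

namespace Summit.ABC.ABC.Theorems

open Literature.NumberTheory.DiophantineGeometry

/-- Witness triples at every radical scale `R ≥ 4`: there is an abc triple with `rad ≤ R` and
`c > R/4`, namely `(1, 2ⁿ - 1, 2ⁿ)` with `2^{n+1} ≤ R < 2^{n+2}`. [folklore] -/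
theorem SubmultOfRST.exists_triple_at_scale {R : ℕ} (hR : 4 ≤ R) :
    ∃ a b c : ℕ, IsABCTriple a b c ∧ rad a b c ≤ R ∧ R < 4 * c := by
  have hm2 : 2 ≤ Nat.log 2 R := Nat.le_log_of_pow_le (by norm_num) (by simpa using hR)
  have hRm : 2 ^ Nat.log 2 R ≤ R := Nat.pow_log_le_self 2 (by omega)
  have hRm' : R < 2 ^ (Nat.log 2 R + 1) := Nat.lt_pow_succ_log_self (by norm_num) R
  obtain ⟨n, hmn⟩ : ∃ n, Nat.log 2 R = n + 1 := ⟨Nat.log 2 R - 1, by omega⟩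
  rw [hmn] at hm2 hRm hRm'
  have hn : n ≠ 0 := by omega
  refine ⟨1, 2 ^ n - 1, 2 ^ n, isABCTriple_one_two_pow_sub_one hn, ?_, ?_⟩
  · calc rad 1 (2 ^ n - 1) (2 ^ n) ≤ 2 * (2 ^ n - 1) := rad_one_two_pow_sub_one_le hn
      _ ≤ 2 ^ (n + 1) := by rw [pow_succ]; omega
      _ ≤ R := hRm
  · calc R < 2 ^ (n + 1 + 1) := hRm'
      _ = 4 * 2 ^ n := by rw [pow_succ, pow_succ]; ring

/-- The radical of an abc triple is at least `2` (since `abc ≥ c ≥ 2`). [folklore] -/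
theorem SubmultOfRST.two_le_rad {a b c : ℕ} (h : IsABCTriple a b c) : 2 ≤ rad a b c := by
  obtain ⟨ha, hb, habc, -⟩ := h
  rw [rad_def, Nat.two_le_radical_iff]
  have hc : 2 ≤ c := by omega
  calc 2 ≤ c := hc
    _ = 1 * 1 * c := by ring
    _ ≤ a * b * c := Nat.mul_le_mul_right c (Nat.mul_le_mul ha hb)

/-- Normalisation of the sub-power slack: with `τ⁺ = max τ 0` and `B = |A| · max 1 ((log 2)^τ)`,
every abc triple with `rad ≤ P` satisfies `A (log rad)^τ ≤ B (log P)^{τ⁺}`. [folklore] -/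
theorem SubmultOfRST.slack_le {τ A : ℝ} {a b c P : ℕ} (h : IsABCTriple a b c) (hP : rad a b c ≤ P) :
    A * Real.log ((rad a b c : ℕ) : ℝ) ^ τ
      ≤ |A| * max 1 (Real.log 2 ^ τ) * Real.log (P : ℝ) ^ max τ 0 := by
  have hrad2 : (2 : ℝ) ≤ ((rad a b c : ℕ) : ℝ) := by exact_mod_cast SubmultOfRST.two_le_rad h
  have hlogr : Real.log 2 ≤ Real.log ((rad a b c : ℕ) : ℝ) := Real.log_le_log two_pos hrad2
  have hlog2 : 0 < Real.log 2 := Real.log_pos one_lt_two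
  have hlogr0 : 0 < Real.log ((rad a b c : ℕ) : ℝ) := hlog2.trans_le hlogr
  have hPR : ((rad a b c : ℕ) : ℝ) ≤ (P : ℝ) := by exact_mod_cast hP
  have hlogP : Real.log ((rad a b c : ℕ) : ℝ) ≤ Real.log (P : ℝ) :=
    Real.log_le_log (two_pos.trans_le hrad2) hPR
  have hlogP0 : 0 ≤ Real.log (P : ℝ) := hlogr0.le.trans hlogP
  have hx0 : 0 ≤ Real.log ((rad a b c : ℕ) : ℝ) ^ τ := Real.rpow_nonneg hlogr0.le τ
  have hM1 : (1 : ℝ) ≤ max 1 (Real.log 2 ^ τ) := le_max_left _ _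
  -- the key scalar bound on `(log rad)^τ`
  have hkey : Real.log ((rad a b c : ℕ) : ℝ) ^ τ
      ≤ max 1 (Real.log 2 ^ τ) * Real.log (P : ℝ) ^ max τ 0 := by
    rcases le_or_gt 0 τ with hτ | hτ
    · rw [max_eq_left hτ]
      calc Real.log ((rad a b c : ℕ) : ℝ) ^ τ ≤ Real.log (P : ℝ) ^ τ :=
            Real.rpow_le_rpow hlogr0.le hlogP hτ
        _ = 1 * Real.log (P : ℝ) ^ τ := (one_mul _).symm
        _ ≤ max 1 (Real.log 2 ^ τ) * Real.log (P : ℝ) ^ τ :=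
            mul_le_mul_of_nonneg_right hM1 (Real.rpow_nonneg hlogP0 τ)
    · rw [max_eq_right hτ.le, Real.rpow_zero, mul_one]
      calc Real.log ((rad a b c : ℕ) : ℝ) ^ τ ≤ Real.log 2 ^ τ :=
            Real.rpow_le_rpow_of_nonpos hlog2 hlogr hτ.le
        _ ≤ max 1 (Real.log 2 ^ τ) := le_max_right _ _
  calc A * Real.log ((rad a b c : ℕ) : ℝ) ^ τ ≤ |A| * Real.log ((rad a b c : ℕ) : ℝ) ^ τ :=
        mul_le_mul_of_nonneg_right (le_abs_self A) hx0
    _ ≤ |A| * (max 1 (Real.log 2 ^ τ) * Real.log (P : ℝ) ^ max τ 0) :=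
        mul_le_mul_of_nonneg_left hkey (abs_nonneg A)
    _ = |A| * max 1 (Real.log 2 ^ τ) * Real.log (P : ℝ) ^ max τ 0 := (mul_assoc _ _ _).symm

/-- Threshold: for every `B` and every `s > 0`, eventually in `P : ℕ` one has `B ≤ (log P)^s`. [folklore] -/
theorem SubmultOfRST.exists_threshold (B : ℝ) {s : ℝ} (hs : 0 < s) :
    ∃ N₀ : ℕ, ∀ P : ℕ, N₀ ≤ P → B ≤ Real.log (P : ℝ) ^ s := by
  have ht : Filter.Tendsto (fun P : ℕ => Real.log (P : ℝ) ^ s) Filter.atTop Filter.atTop :=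
    (tendsto_rpow_atTop hs).comp (Real.tendsto_log_atTop.comp tendsto_natCast_atTop_atTop)
  exact Filter.eventually_atTop.mp (ht.eventually_ge_atTop B)

/-- **`SubmultOfRST` (stmt-ABC-10340).**  If for some `τ < 1` and some real `A` every abc triple
satisfies `c < rad(abc) · exp(A (log rad)^τ)`, then `ScaleSubmultiplicativity` holds (with
`θ = (1 + max τ 0)/2 < 1`, `K = 16`, `R₀` large): every abc triple with `rad ≤ R₁R₂` is dominated by
`16 · e^{(log R₁R₂)^θ} · c₁ c₂` for the witness triples `(1, 2ⁿ - 1, 2ⁿ)` at the scales `R₁`, `R₂`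
(`cᵢ > Rᵢ/4`).  Support item of route `FeketeScales`; the hypothesis is the sub-power slack implied by
Robert–Stewart–Tenenbaum's Conjecture A (upper half) [cite: RobertStewartTenenbaum2014, §1]. -/
theorem submultOfRST_proof : Summit.ABC.ABC.Theses.FeketeScales.SubmultOfRST := by
  unfold Summit.ABC.ABC.Theses.FeketeScales.SubmultOfRST
    Summit.ABC.ABC.Theses.FeketeScales.ScaleSubmultiplicativity
  rintro ⟨τ, hτ1, A, hA⟩
  -- normalised exponent and constant
  set t : ℝ := max τ 0 with ht_def
  have ht0 : 0 ≤ t := le_max_right _ _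
  have ht1 : t < 1 := max_lt hτ1 one_pos
  set B : ℝ := |A| * max 1 (Real.log 2 ^ τ) with hB_def
  set s : ℝ := (1 - t) / 2 with hs_def
  have hs : 0 < s := by rw [hs_def]; linarith
  obtain ⟨N₀, hN₀⟩ := SubmultOfRST.exists_threshold B hs
  refine ⟨(1 + t) / 2, by linarith, 16, by norm_num, max 4 N₀, ?_⟩
  intro R₁ R₂ hR₁ hR₂ a b c habc hrad
  have hR₁4 : 4 ≤ R₁ := (le_max_left _ _).trans hR₁
  have hR₂4 : 4 ≤ R₂ := (le_max_left _ _).trans hR₂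
  obtain ⟨a₁, b₁, c₁, h₁, hrad₁, hc₁⟩ := SubmultOfRST.exists_triple_at_scale hR₁4
  obtain ⟨a₂, b₂, c₂, h₂, hrad₂, hc₂⟩ := SubmultOfRST.exists_triple_at_scale hR₂4
  refine ⟨a₁, b₁, c₁, a₂, b₂, c₂, h₁, hrad₁, h₂, hrad₂, ?_⟩
  -- the scale `P = R₁ R₂`
  set P : ℕ := R₁ * R₂ with hP_def
  have hPN : N₀ ≤ P := by
    calc N₀ ≤ R₁ := (le_max_right _ _).trans hR₁
      _ = R₁ * 1 := (mul_one _).symm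
      _ ≤ R₁ * R₂ := Nat.mul_le_mul_left R₁ (by omega)
  have hP16 : P < 16 * (c₁ * c₂) := by
    calc P = R₁ * R₂ := rfl
      _ < (4 * c₁) * (4 * c₂) := Nat.mul_lt_mul'' hc₁ hc₂
      _ = 16 * (c₁ * c₂) := by ring
  have hPreal : ((R₁ : ℝ) * R₂) = (P : ℝ) := by rw [hP_def]; push_cast; ring
  have hP1 : (1 : ℝ) ≤ (P : ℝ) := by
    have : 1 ≤ P := by rw [hP_def]; exact Nat.one_le_iff_ne_zero.mpr (by positivity)
    exact_mod_cast this
  have hlogP0 : 0 ≤ Real.log (P : ℝ) := Real.log_nonneg hP1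
  -- slack at scale `P`
  have hslack : A * Real.log ((rad a b c : ℕ) : ℝ) ^ τ ≤ Real.log (P : ℝ) ^ ((1 + t) / 2) := by
    calc A * Real.log ((rad a b c : ℕ) : ℝ) ^ τ ≤ B * Real.log (P : ℝ) ^ t :=
          SubmultOfRST.slack_le habc hrad
      _ ≤ Real.log (P : ℝ) ^ s * Real.log (P : ℝ) ^ t :=
          mul_le_mul_of_nonneg_right (hN₀ P hPN) (Real.rpow_nonneg hlogP0 t)
      _ = Real.log (P : ℝ) ^ (s + t) := (Real.rpow_add_of_nonneg hlogP0 hs.le ht0).symm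
      _ = Real.log (P : ℝ) ^ ((1 + t) / 2) := by rw [hs_def]; ring_nf
  -- assembly
  have hradP : ((rad a b c : ℕ) : ℝ) ≤ (P : ℝ) := by exact_mod_cast hrad
  have hrad0 : (0 : ℝ) ≤ ((rad a b c : ℕ) : ℝ) := Nat.cast_nonneg _
  have hexp0 : 0 ≤ Real.exp (Real.log (P : ℝ) ^ ((1 + t) / 2)) := (Real.exp_pos _).le
  have hP16r : (P : ℝ) ≤ 16 * ((c₁ : ℝ) * c₂) := by exact_mod_cast hP16.le
  have key : (c : ℝ) ≤ 16 * ((c₁ : ℝ) * c₂) * Real.exp (Real.log (P : ℝ) ^ ((1 + t) / 2)) :=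
    calc (c : ℝ) ≤ ((rad a b c : ℕ) : ℝ) * Real.exp (A * Real.log ((rad a b c : ℕ) : ℝ) ^ τ) :=
          (hA a b c habc).le
      _ ≤ (P : ℝ) * Real.exp (Real.log (P : ℝ) ^ ((1 + t) / 2)) :=
          mul_le_mul hradP (Real.exp_le_exp.mpr hslack) (Real.exp_pos _).le (Nat.cast_nonneg _)
      _ ≤ 16 * ((c₁ : ℝ) * c₂) * Real.exp (Real.log (P : ℝ) ^ ((1 + t) / 2)) :=
          mul_le_mul_of_nonneg_right hP16r hexp0
  calc (c : ℝ) ≤ 16 * ((c₁ : ℝ) * c₂) * Real.exp (Real.log (P : ℝ) ^ ((1 + t) / 2)) := key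
    _ = 16 * Real.exp (Real.log ((R₁ : ℝ) * R₂) ^ ((1 + t) / 2)) * c₁ * c₂ := by
        rw [hPreal]; ring

end Summit.ABC.ABC.Theorems
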